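import Mathlib

/-!
# Manin–Gamma cell (pub-manin-gamma0): square roots of 1 modulo 2^e (seat p1, gen 2) — group core of Lemma 4.4(ii)

`proofs/T1_lead.md` Lemma 4.4(ii) / `proofs/AppA_descent_lead.md` §B(ii): for `e ≥ 3` the group `(ℤ/2^e)^×` has exactly
three characters of order 2 (square classes `−1, 2, −2`), for `e = 2` exactly one (`−1`), for `e ≤ 1` none. By
`|G/G²| = |G[2]|` (TorsionCount) this is the count of solutions of `x² = 1` in `(ℤ/2^e)^×`. This file proves the
2-adic core: `x² ≡ 1 (mod 2^e)`, `e ≥ 2` ⟹ `x ≡ ±1 (mod 2^{e−1})`, hence `x ≡ ±1` or `±1 + 2^{e−1} (mod 2^e)` — at most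
four square roots of unity — and conversely these four are square roots of unity.

* `ManinGamma.TwoPowerSquareRoots.sq_eq_one_mod_two_pow`
* `ManinGamma.TwoPowerSquareRoots.sq_eq_one_mod_two_pow_cases`
* `ManinGamma.TwoPowerSquareRoots.sq_of_pm_one_add`
Only Mathlib is imported; no `sorry`.
-/

namespace ManinGamma.TwoPowerSquareRoots

/-- If `x² ≡ 1 (mod 2^e)` with `e ≥ 2`, then `x ≡ 1` or `x ≡ −1 (mod 2^{e−1})`. -/
theorem sq_eq_one_mod_two_pow {e : ℕ} (he : 2 ≤ e) {x : ℤ} (hx : x ^ 2 ≡ 1 [ZMOD 2 ^ e]) :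
    x ≡ 1 [ZMOD 2 ^ (e - 1)] ∨ x ≡ -1 [ZMOD 2 ^ (e - 1)] := by
  obtain ⟨e', rfl⟩ : ∃ e', e = e' + 2 := ⟨e - 2, by omega⟩
  have hsub : e' + 2 - 1 = e' + 1 := by omega
  rw [hsub]
  have hdvd : (2 : ℤ) ^ (e' + 2) ∣ x ^ 2 - 1 := Int.modEq_iff_dvd.mp hx.symm
  -- x is odd
  have h2 : (2 : ℤ) ∣ x ^ 2 - 1 := dvd_trans (dvd_pow_self 2 (by omega)) hdvd
  have hxodd : Odd x := by
    rcases Int.even_or_odd x with ⟨k, hk⟩ | hodd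
    · exfalso
      have e1 : x ^ 2 - 1 = 2 * (2 * k ^ 2) - 1 := by rw [hk]; ring
      rw [e1] at h2
      have h1 : (2 : ℤ) ∣ 1 := by
        have h := dvd_sub (dvd_mul_right (2 : ℤ) (2 * k ^ 2)) h2
        rwa [show (2 : ℤ) * (2 * k ^ 2) - (2 * (2 * k ^ 2) - 1) = 1 by ring] at h
      omega
    · exact hodd
  obtain ⟨k, rfl⟩ := hxodd
  -- (2k+1)² − 1 = 4 k (k+1) and 2^(e'+2) = 4·2^e'
  have e2 : (2 * k + 1) ^ 2 - 1 = 4 * (k * (k + 1)) := by ring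
  have e3 : (2 : ℤ) ^ (e' + 2) = 4 * 2 ^ e' := by ring
  rw [e2, e3] at hdvd
  have hdvd' : (2 : ℤ) ^ e' ∣ k * (k + 1) := (mul_dvd_mul_iff_left (by norm_num : (4 : ℤ) ≠ 0)).mp hdvd
  rcases Int.even_or_odd k with ⟨j, hj⟩ | ⟨j, hj⟩
  · -- k even: k + 1 odd, so 2^e' ∣ k, so x = 2k+1 ≡ 1 (mod 2^(e'+1))
    have hcop : IsCoprime ((2 : ℤ) ^ e') (k + 1) := by
      apply IsCoprime.pow_left
      rw [hj]; exact ⟨-j, 1, by ring⟩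
    have hk : (2 : ℤ) ^ e' ∣ k := hcop.dvd_of_dvd_mul_right hdvd'
    left
    rw [Int.modEq_iff_dvd]
    obtain ⟨m, hm⟩ := hk
    exact ⟨-m, by rw [hm]; ring⟩
  · -- k odd: 2^e' ∣ k+1, so x = 2k+1 = 2(k+1) − 1 ≡ −1 (mod 2^(e'+1))
    have hcop : IsCoprime ((2 : ℤ) ^ e') k := by
      apply IsCoprime.pow_left
      rw [hj]; exact ⟨-j, 1, by ring⟩
    have hk : (2 : ℤ) ^ e' ∣ k + 1 := hcop.dvd_of_dvd_mul_left hdvd'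
    right
    rw [Int.modEq_iff_dvd]
    obtain ⟨m, hm⟩ := hk
    exact ⟨-m, by linear_combination (-2 : ℤ) * hm⟩

/-- Refinement: `x² ≡ 1 (mod 2^e)`, `e ≥ 2` ⟹ `x ≡ ε + δ·2^{e−1} (mod 2^e)` with `ε ∈ {1,−1}`, `δ ∈ {0,1}` — at most four
square roots of unity modulo `2^e`. -/
theorem sq_eq_one_mod_two_pow_cases {e : ℕ} (he : 2 ≤ e) {x : ℤ} (hx : x ^ 2 ≡ 1 [ZMOD 2 ^ e]) :
    ∃ ε δ : ℤ, (ε = 1 ∨ ε = -1) ∧ (δ = 0 ∨ δ = 1) ∧ x ≡ ε + δ * 2 ^ (e - 1) [ZMOD 2 ^ e] := by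
  have hpow : (2 : ℤ) ^ e = 2 * 2 ^ (e - 1) := by
    obtain ⟨e', rfl⟩ : ∃ e', e = e' + 1 := ⟨e - 1, by omega⟩
    simp [pow_succ, mul_comm]
  -- from x ≡ ε (mod 2^(e-1)) write x = ε + 2^(e-1) t and split on the parity of t
  have key : ∀ ε : ℤ, x ≡ ε [ZMOD 2 ^ (e - 1)] →
      ∃ δ : ℤ, (δ = 0 ∨ δ = 1) ∧ x ≡ ε + δ * 2 ^ (e - 1) [ZMOD 2 ^ e] := by
    intro ε h
    obtain ⟨t, ht⟩ := Int.modEq_iff_dvd.mp h.symm   -- x - ε = 2^(e-1) * t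
    rcases Int.even_or_odd t with ⟨s, hs⟩ | ⟨s, hs⟩
    · refine ⟨0, Or.inl rfl, ?_⟩
      rw [Int.modEq_iff_dvd, hpow]
      exact ⟨-s, by linear_combination (-1 : ℤ) * ht - (2 : ℤ) ^ (e - 1) * hs⟩
    · refine ⟨1, Or.inr rfl, ?_⟩
      rw [Int.modEq_iff_dvd, hpow]
      exact ⟨-s, by linear_combination (-1 : ℤ) * ht - (2 : ℤ) ^ (e - 1) * hs⟩
  rcases sq_eq_one_mod_two_pow he hx with h | h
  · obtain ⟨δ, hδ, hc⟩ := key 1 h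
    exact ⟨1, δ, Or.inl rfl, hδ, hc⟩
  · obtain ⟨δ, hδ, hc⟩ := key (-1) h
    exact ⟨-1, δ, Or.inr rfl, hδ, hc⟩

/-- Conversely, for `e ≥ 2` each `ε + δ·2^{e−1}` (`ε = ±1`, `δ ∈ ℤ`) is a square root of unity modulo `2^e`. -/
theorem sq_of_pm_one_add {e : ℕ} (he : 2 ≤ e) (ε δ : ℤ) (hε : ε = 1 ∨ ε = -1) :
    (ε + δ * 2 ^ (e - 1)) ^ 2 ≡ 1 [ZMOD 2 ^ e] := by
  obtain ⟨e', rfl⟩ : ∃ e', e = e' + 2 := ⟨e - 2, by omega⟩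
  have hsub : e' + 2 - 1 = e' + 1 := by omega
  rw [hsub, Int.modEq_iff_dvd]
  have hε2 : ε ^ 2 = 1 := by rcases hε with rfl | rfl <;> norm_num
  -- 1 − (ε + δ 2^(e'+1))² = −(2 ε δ 2^(e'+1) + δ² 2^(2e'+2)) = 2^(e'+2)·(−εδ − δ² 2^e')
  refine ⟨-(ε * δ) - δ ^ 2 * 2 ^ e', ?_⟩
  have : (2 : ℤ) ^ (e' + 1) = 2 * 2 ^ e' := by ring
  rw [this]
  linear_combination (-1 : ℤ) * hε2

end ManinGamma.TwoPowerSquareRoots
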